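import Summits.CriticalPhenomena.PercolationContinuityZ3.Theorems.PercNearOneGluingNoHeavyLowerTailSetPortStripping
import Summits.CriticalPhenomena.PercolationContinuityZ3.Theorems.PercNearOneGluingNoHeavyLowerTailSetGapStability
import HarnessLib

/-!
# `NoHeavyLowerTail` (stmt-CriticalPhenomena-4575) — the cumulative isolation lemma at a depth-two observer from glued
# port domination of its light stars

Support file (prover `prim-hp-6`, hull-port cell; `--supports stmt-CriticalPhenomena-4575`).  No definitions, no named
facts, no sorries.  Assembles the star transfer (`Theorems.cil_of_setGap_deleted`) with the set-port transport
(`SetPort.setCS_of_strip`, `SetPort.setCS_of_gluedPortDomination`, `SetPort.setCS_of_offBest`).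

Notation: `μ_w = prodBernoulli w` on `Fin n`, relays `A`, level `j`, observer `o ∉ A`; `w ∖ o` = the weights off `o`
(`fun e => if o ∉ e then w e else 0`, the graph `G − o`), lightness `I(y) = μ_{w∖o}{|π(y)| ≤ j}`, `c` a champion of `w ∖ o`.
A DEPTH-TWO observer: every positive-weight neighbour of `o` that is not a relay has all its other positive pairs going to
relays (so every star of such neighbours is a relay-neighboured Steiner set of `G − o`).

* `SetPort.setCS_of_noPort` — a set with no positive pair to its outside carries no bad mass: `CS_w(U, c)` trivially.
* `SetPort.cil_depthTwo_of_gluedDomination` — **CIL at a depth-two observer from glued port domination.**  If for every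
  nonempty set `B` of light non-relay neighbours of `o` and every port `p ≠ c` of `B`, the glued lightness of `p` is at most that
  of `c` in the graph `(G − o) ⊖ (B, c)` (pairs `B–c` switched off), then `μ{1 ≤ N ≤ j} ≤ μ{|π(c)| ≤ j}`.  The hypothesis is a
  CERTIFICATE, not a theorem: it holds in all but a handful of ~3·10⁴ exact checks (crux evidence HP6-MEMO2-SDX-UGD.md §F–§H,
  with an explicit 8-vertex failure by 2.8·10⁻⁵ at which the conclusion still holds).
* `SetPort.cil_depthTwo_of_offBest` — **unconditional corollary:** the same conclusion whenever, for every such star `B`,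
  `c` is at least as light as every port of `B` in `G − o − B`.
-/

noncomputable section

namespace Summit.CriticalPhenomena.PercolationContinuityZ3.Theorems

open MeasureTheory Set Literature.Probability.LatticeModels Literature.Probability.Percolation
open scoped Classical BigOperators

variable {n : ℕ}

namespace SetPort

/-- A set `U` (disjoint from `A`) with no positive pair to its outside is joined to no relay almost surely, so
`CS_w(U, c)` holds trivially. [folklore] -/
theorem setCS_of_noPort (w : Sym2 (Fin n) → unitInterval) (A U : Finset (Fin n)) (hUA : Disjoint U A) (c : Fin n)
    (j : ℕ) (hno : ∀ x ∈ U, ∀ v : Fin n, v ∉ U → w s(x, v) = 0) :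
    (prodBernoulli w).real {ω : BondConfig (Fin n) | (∀ x ∈ U, ω ∉ openConn c x) ∧
        1 ≤ (A.filter fun z => ∃ x ∈ U, ω ∈ openConn x z).card ∧
        (A.filter fun z => ∃ x ∈ U, ω ∈ openConn x z).card ≤ j} ≤
      (prodBernoulli w).real {ω : BondConfig (Fin n) | (∀ x ∈ U, ω ∉ openConn c x) ∧
        (A.filter fun z => ω ∈ openConn c z).card ≤ j} := by
  have h0 : (prodBernoulli w).real {ω : BondConfig (Fin n) | (∀ x ∈ U, ω ∉ openConn c x) ∧
      1 ≤ (A.filter fun z => ∃ x ∈ U, ω ∈ openConn x z).card ∧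
      (A.filter fun z => ∃ x ∈ U, ω ∈ openConn x z).card ≤ j} = 0 := by
    rw [← CutObserver.measureReal_inter_support w]
    have : ({ω : BondConfig (Fin n) | (∀ x ∈ U, ω ∉ openConn c x) ∧
        1 ≤ (A.filter fun z => ∃ x ∈ U, ω ∈ openConn x z).card ∧
        (A.filter fun z => ∃ x ∈ U, ω ∈ openConn x z).card ≤ j} ∩ {ω | ∀ e ∈ ω, w e ≠ 0}) = ∅ := by
      ext ω
      simp only [mem_inter_iff, mem_setOf_eq, mem_empty_iff_false, iff_false]
      rintro ⟨⟨-, h1, -⟩, hsupp⟩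
      obtain ⟨z, hz⟩ := Finset.card_pos.1 (by omega : 0 < (A.filter fun z => ∃ x ∈ U, ω ∈ openConn x z).card)
      obtain ⟨hzA, x, hx, hxz⟩ := Finset.mem_filter.1 hz
      have hzU : z ∉ U := fun h => Finset.disjoint_left.1 hUA h hzA
      obtain ⟨x', hx', v, hv, hxv, -⟩ := exists_exit_of_reachable U hx hzU hxz
      exact hsupp _ hxv (hno x' hx' v hv)
    rw [this, measureReal_empty]
  rw [h0]; exact measureReal_nonneg

/-- **CIL at a depth-two observer from glued port domination of its light stars.**  Let `o ∉ A`, let `c ∈ A` be a champion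
of `w ∖ o` (`I(a) ≤ I(c)` for all `a ∈ A`), and let every non-relay positive-weight neighbour `y` of `o` have all its other
positive pairs going to relays.  Suppose that for every nonempty set `B` of light (`I(c) < I(y)`) non-relay neighbours of `o`
having a port other than `c`, with `w_B = (w ∖ o)` with the pairs `B–c` switched off, and whose members are all still lighter than `c`
under `w_B`, every port `p` of `B` in `w_B` satisfies `J_{w_B}(B, p) ≤ J_{w_B}(B, c)` (glued lightness).  (Stars with a member no
lighter than `c` under `w_B` need nothing: the lonelier-member lemma `Theorems.setGap_of_member_le` serves them.)  Then `μ{1 ≤ N ≤ j} ≤ μ{|π(c)| ≤ j}`.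
[cite: VandenbergHaggstromKahn2005, Thm. 1.5 (p. 7) — via `cil_of_setGap_deleted`, `cil_of_portDomination`] -/
theorem cil_depthTwo_of_gluedDomination (w : Sym2 (Fin n) → unitInterval) (A : Finset (Fin n)) (o c : Fin n) (j : ℕ)
    (hoA : o ∉ A) (hcA : c ∈ A)
    (hchamp : ∀ a ∈ A,
      (prodBernoulli fun e => if e ∈ {e : Sym2 (Fin n) | o ∉ e} then w e else 0).real
          {ξ : BondConfig (Fin n) | (A.filter fun z => ξ ∈ openConn a z).card ≤ j} ≤
        (prodBernoulli fun e => if e ∈ {e : Sym2 (Fin n) | o ∉ e} then w e else 0).real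
          {ξ : BondConfig (Fin n) | (A.filter fun z => ξ ∈ openConn c z).card ≤ j})
    (hdepth : ∀ y : Fin n, y ∉ A → y ≠ o → w s(o, y) ≠ 0 → ∀ v : Fin n, v ≠ o → v ≠ y → w s(y, v) ≠ 0 → v ∈ A)
    (hdom : ∀ B : Finset (Fin n), B.Nonempty → Disjoint B A → (∀ y ∈ B, y ≠ o ∧ w s(o, y) ≠ 0) →
      let wB : Sym2 (Fin n) → unitInterval := fun e =>
        if e ∈ B.image (fun x => s(x, c)) then 0 else if e ∈ {e : Sym2 (Fin n) | o ∉ e} then w e else 0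
      (∃ x ∈ B, ∃ v : Fin n, v ∉ B ∧ wB s(x, v) ≠ 0) →
      (∀ y ∈ B, (prodBernoulli wB).real {ξ : BondConfig (Fin n) | (A.filter fun z => ξ ∈ openConn c z).card ≤ j} <
        (prodBernoulli wB).real {ξ : BondConfig (Fin n) | (A.filter fun z => ξ ∈ openConn y z).card ≤ j}) →
      ∀ p ∈ A, (∃ x ∈ B, wB s(x, p) ≠ 0) →
        (prodBernoulli wB).real {ω : BondConfig (Fin n) | (∀ x ∈ B, ω ∉ openConn p x) ∧
            (A.filter fun z => ω ∈ openConn p z).card ≤ j} +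
          (prodBernoulli wB).real {ω : BondConfig (Fin n) | (∃ x ∈ B, ω ∈ openConn p x) ∧
            (A.filter fun z => ∃ x ∈ B, ω ∈ openConn x z).card ≤ j} ≤
        (prodBernoulli wB).real {ω : BondConfig (Fin n) | (∀ x ∈ B, ω ∉ openConn c x) ∧
            (A.filter fun z => ω ∈ openConn c z).card ≤ j} +
          (prodBernoulli wB).real {ω : BondConfig (Fin n) | (∃ x ∈ B, ω ∈ openConn c x) ∧
            (A.filter fun z => ∃ x ∈ B, ω ∈ openConn x z).card ≤ j}) :
    (prodBernoulli w).real {ω : BondConfig (Fin n) |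
        1 ≤ (A.filter fun x => ω ∈ openConn o x).card ∧ (A.filter fun x => ω ∈ openConn o x).card ≤ j} ≤
      (prodBernoulli w).real {ω : BondConfig (Fin n) | (A.filter fun x => ω ∈ openConn c x).card ≤ j} := by
  set wo : Sym2 (Fin n) → unitInterval := fun e => if e ∈ {e : Sym2 (Fin n) | o ∉ e} then w e else 0 with hwo
  refine cil_of_setGap_deleted w A o c j hoA hcA fun B hBne hB => ?_
  -- members of `B` are light, hence not relays, and adjacent to `o`
  have hBA : Disjoint B A := by
    rw [Finset.disjoint_left]
    intro y hy hyA
    exact absurd (hchamp y hyA) (not_le.2 (hB y hy).2.2)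
  have hBo : ∀ y ∈ B, y ≠ o ∧ w s(o, y) ≠ 0 := fun y hy => ⟨(hB y hy).1, (hB y hy).2.1⟩
  have hcB : c ∉ B := fun h => Finset.disjoint_left.1 hBA h hcA
  -- strip the pairs `B–c`
  set wB : Sym2 (Fin n) → unitInterval := fun e =>
    if e ∈ B.image (fun x => s(x, c)) then 0 else if e ∈ {e : Sym2 (Fin n) | o ∉ e} then w e else 0 with hwB
  have hoff : ∀ e : Sym2 (Fin n), e ∉ B.image (fun x => s(x, c)) → wB e = wo e := by
    intro e he; simp only [hwB, hwo, he, if_false]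
  have hzero : ∀ x ∈ B, wB s(x, c) = 0 := by
    intro x hx
    have : s(x, c) ∈ B.image (fun x => s(x, c)) := Finset.mem_image.2 ⟨x, hx, rfl⟩
    simp only [hwB, this, if_true]
  refine setCS_of_strip wo wB A B c hcB j hoff hzero ?_
  -- `B` is relay-neighboured in `wB`
  have hRN : ∀ x ∈ B, ∀ v : Fin n, v ∉ B → wB s(x, v) ≠ 0 → v ∈ A := by
    intro x hx v hvB hxv
    have h1 : s(x, v) ∉ B.image (fun x => s(x, c)) := by
      intro h; rw [hwB] at hxv; simp only [h, if_true] at hxv; exact hxv rfl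
    have h2 : wo s(x, v) ≠ 0 := by rwa [hoff _ h1] at hxv
    have hov : o ∉ s(x, v) := by
      intro h; apply h2; simp only [hwo]; rw [if_neg]; exact fun h' => h' h
    have hxv' : w s(x, v) ≠ 0 := by
      intro h; apply h2; simp only [hwo]; split_ifs <;> simp [h]
    have hvo : v ≠ o := fun h => hov (h ▸ Sym2.mem_mk_right x v)
    have hvx : v ≠ x := fun h => hvB (h ▸ hx)
    have hxA : x ∉ A := fun h => Finset.disjoint_left.1 hBA hx h
    exact hdepth x hxA (hBo x hx).1 (hBo x hx).2 v hvo hvx hxv'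
  by_cases hlight : ∀ y ∈ B,
      (prodBernoulli wB).real {ξ : BondConfig (Fin n) | (A.filter fun z => ξ ∈ openConn c z).card ≤ j} <
        (prodBernoulli wB).real {ξ : BondConfig (Fin n) | (A.filter fun z => ξ ∈ openConn y z).card ≤ j}
  swap
  · -- a member no lighter than `c` under `wB`: the lonelier-member lemma
    have hlight' : ∃ y ∈ B,
        (prodBernoulli wB).real {ξ : BondConfig (Fin n) | (A.filter fun z => ξ ∈ openConn y z).card ≤ j} ≤
          (prodBernoulli wB).real {ξ : BondConfig (Fin n) | (A.filter fun z => ξ ∈ openConn c z).card ≤ j} := by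
      by_contra h
      exact hlight fun y hy => lt_of_not_ge fun hge => h ⟨y, hy, hge⟩
    obtain ⟨y, hy, hyc⟩ := hlight'
    have key := setGap_of_member_le wB A B y c c hy j le_rfl hyc
    linarith
  by_cases hport : ∃ x ∈ B, ∃ v : Fin n, v ∉ B ∧ wB s(x, v) ≠ 0
  · exact setCS_of_gluedPortDomination wB A B hBA c hcA j hRN hport (hdom B hBne hBA hBo hport hlight)
  · exact setCS_of_noPort wB A B hBA c j fun x hx v hv => by
      by_contra h; exact hport ⟨x, hx, v, hv, h⟩

/-- **CIL at a depth-two observer, unconditional case.**  As in `cil_depthTwo_of_gluedDomination`, but assuming instead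
that for every nonempty set `B` of light non-relay neighbours of `o`, `c` is at least as light as every port of `B` in the
graph `G − o − B` (all pairs meeting `B` or `o` switched off).  Then `μ{1 ≤ N ≤ j} ≤ μ{|π(c)| ≤ j}`.
[cite: VandenbergHaggstromKahn2005, Thm. 1.5 (p. 7) — via `cil_of_setGap_deleted`, `portComparison_of_separation`] -/
theorem cil_depthTwo_of_offBest (w : Sym2 (Fin n) → unitInterval) (A : Finset (Fin n)) (o c : Fin n) (j : ℕ)
    (hoA : o ∉ A) (hcA : c ∈ A)
    (hchamp : ∀ a ∈ A,
      (prodBernoulli fun e => if e ∈ {e : Sym2 (Fin n) | o ∉ e} then w e else 0).real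
          {ξ : BondConfig (Fin n) | (A.filter fun z => ξ ∈ openConn a z).card ≤ j} ≤
        (prodBernoulli fun e => if e ∈ {e : Sym2 (Fin n) | o ∉ e} then w e else 0).real
          {ξ : BondConfig (Fin n) | (A.filter fun z => ξ ∈ openConn c z).card ≤ j})
    (hdepth : ∀ y : Fin n, y ∉ A → y ≠ o → w s(o, y) ≠ 0 → ∀ v : Fin n, v ≠ o → v ≠ y → w s(y, v) ≠ 0 → v ∈ A)
    (hbest : ∀ B : Finset (Fin n), B.Nonempty → Disjoint B A → (∀ y ∈ B, y ≠ o ∧ w s(o, y) ≠ 0) →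
      let wo : Sym2 (Fin n) → unitInterval := fun e => if e ∈ {e : Sym2 (Fin n) | o ∉ e} then w e else 0
      ∀ p ∈ A, (∃ x ∈ B, wo s(x, p) ≠ 0) →
        (prodBernoulli fun e => if (∀ u ∈ B, u ∉ e) then wo e else 0).real
            {ω : BondConfig (Fin n) | (A.filter fun z => ω ∈ openConn p z).card ≤ j} ≤
          (prodBernoulli fun e => if (∀ u ∈ B, u ∉ e) then wo e else 0).real
            {ω : BondConfig (Fin n) | (A.filter fun z => ω ∈ openConn c z).card ≤ j}) :
    (prodBernoulli w).real {ω : BondConfig (Fin n) |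
        1 ≤ (A.filter fun x => ω ∈ openConn o x).card ∧ (A.filter fun x => ω ∈ openConn o x).card ≤ j} ≤
      (prodBernoulli w).real {ω : BondConfig (Fin n) | (A.filter fun x => ω ∈ openConn c x).card ≤ j} := by
  set wo : Sym2 (Fin n) → unitInterval := fun e => if e ∈ {e : Sym2 (Fin n) | o ∉ e} then w e else 0 with hwo
  refine cil_of_setGap_deleted w A o c j hoA hcA fun B hBne hB => ?_
  have hBA : Disjoint B A := by
    rw [Finset.disjoint_left]
    intro y hy hyA
    exact absurd (hchamp y hyA) (not_le.2 (hB y hy).2.2)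
  have hBo : ∀ y ∈ B, y ≠ o ∧ w s(o, y) ≠ 0 := fun y hy => ⟨(hB y hy).1, (hB y hy).2.1⟩
  have hRN : ∀ x ∈ B, ∀ v : Fin n, v ∉ B → wo s(x, v) ≠ 0 → v ∈ A := by
    intro x hx v hvB hxv
    have hov : o ∉ s(x, v) := by
      intro h; apply hxv; simp only [hwo]; rw [if_neg]; exact fun h' => h' h
    have hxv' : w s(x, v) ≠ 0 := by
      intro h; apply hxv; simp only [hwo]; split_ifs <;> simp [h]
    have hvo : v ≠ o := fun h => hov (h ▸ Sym2.mem_mk_right x v)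
    have hvx : v ≠ x := fun h => hvB (h ▸ hx)
    have hxA : x ∉ A := fun h => Finset.disjoint_left.1 hBA hx h
    exact hdepth x hxA (hBo x hx).1 (hBo x hx).2 v hvo hvx hxv'
  by_cases hport : ∃ x ∈ B, ∃ v : Fin n, v ∉ B ∧ wo s(x, v) ≠ 0
  · exact setCS_of_offBest wo A B hBA c hcA j hRN hport (hbest B hBne hBA hBo)
  · exact setCS_of_noPort wo A B hBA c j fun x hx v hv => by
      by_contra h; exact hport ⟨x, hx, v, hv, h⟩

end SetPort

end Summit.CriticalPhenomena.PercolationContinuityZ3.Theorems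

end
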